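/- COR-CM (cell pub-hodgecm2) — Δ2 BRIDGE, ORIENTATION: the two keyings of [Liu2021, Thm. 4.18] at one pin are JOINTLY inhabitable only where
the holomorphic `K`-fixed vectors of the tower vanish.  Wall-breaker wb-5 (prover-pub-hodgecm2-d2bridge-wb-5-g1-0).  THEOREMS ONLY; nothing
landed is edited or restated; no named fact, no `sorry`; explicit per-theorem binders.  FRAMING: HC_CM is NOT proved; «Δ2 BRIDGE CLOSED» is NOT
claimed; NO orientation verdict is asserted — the file is symmetric in the two keys. -/
import Summits.HodgeConjecture.CorCM.D2Bridge.CmClassesHodgeType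
import Summits.HodgeConjecture.CorCM.D2Bridge.OrientationReflexConj
import Summits.HodgeConjecture.CorCM.D2Bridge.OrientationT2BlockVanishing
import Literature.AlgebraicGeometry.HodgeTheory.AbelianVarietyHodgeHomFullnessHolds
import HarnessLib

/-!
# Δ2 bridge, orientation: `h418` (keys at `ι₁`) ∧ `h418′` (keys at `ῑ₁`) ∧ [Liu2021, Prop. 4.13] ∧ (T1) ⇒ holomorphic fixed vectors vanish

NO (T2), NO (T4).  Let `T : LiuDictionary hHD hI h₁ h₃ V` be a real-carrier dictionary at the pin `(V, ι₁)` ([Liu2021] §4.2 at the model)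
satisfying its combined reading r8 (`T.Thm418C`, keys `T.PhiMu ∕ T.adm`), and let a SECOND key be given on the same carriers — a predicate
`P₂` on `T.Char` and generator sets `cmCl₂ K μ` — satisfying r8 in the same currency (`h418₂`, unfolded `Thm418Combined T.res cmCl₂` guarded
by `P₂`).  Suppose (i) every character is `PhiMu` for one of the two keys (`T.PhiMu μ ∨ P₂ μ`), (ii) each key's generators at its own `PhiMu`
characters are of Hodge type `(1,0)` on `P_K`, (iii) [Liu2021, Prop. 4.13] for `T` (`T.Prop413`: `H ≃ ⨁_t ω(t)` as `ℂ[U(V)(𝔸_f)]`-modules), and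
(T1) a map `F : T.H → T.H` preserving `Γ.K`-fixed vectors with `T.res Γ (F x) = (conj ⊗ id) (T.res Γ x)` on them (instlevel-a's `conjTower`).
THEN every vector `x ∈ T.H` has a threshold below which «`Γ.K`-fixed and `T.res Γ x` of type `(1,0)`» forces `T.res Γ x = 0`
(`res_eq_zero_of_thm418C_two_keys`): decompose `F x = Σ_t (F x)_t` along Prop. 4.13 (the projections are `ℂ[G]`-linear, so the components
are `Γ.K`-fixed and lie in their blocks — the bookkeeping of the junction theorem `subset_span_of_liuDictionary`); below the minimum of the
finitely many thresholds each `T.res Γ (F x)_t` lies in a `(1,0)` span (key 1 or key 2 according to (i)); so `(conj ⊗ id)(T.res Γ x) =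
T.res Γ (F x)` is `(1,0)`, while it is `(0,1)` by Hodge symmetry; `H^{1,0} ⊓ H^{0,1} = ⊥`.

AT THE LITERAL PIN (`res_eq_zero_pin_of_thm418C_two_keys`, `L/ℚ` Galois): `T := liuDictionaryPin hHD hI h₁ h₃ hA V I line` (live: `PhiMu i =
(ι₁ ∈ typeOfLine (line i))`, `adm i d = d.IsReflexOfTypeG ι₁ (typeOfLine (line i))`), second key = the re-keyed twin's
(`P₂ i := ῑ₁ ∈ typeOfLine (line i)`, `cmCl₂ := cmClasses` of `LiuDictionary.ofTower … (PhiMuLine ῑ₁ ∘ line) (IsReflexOfTypeG ῑ₁ ∘ typeOfLine ∘ line)`,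
written out — `= Rekey.liuDictionaryPin` of the (c-S.1) chain by `rfl`, not imported): (i) is the CM-type dichotomy `ι₁ ∈ Φ ∨ ῑ₁ ∈ Φ`, (ii) is K2
(`tau_mem_cmType_of_isReflexOfType`, resp. `…_starRingEnd_comp`) + ✔ `cmClasses_subset_hodge_piece_one_zero`; left displayed: `Prop413` (a
cited sentence of the END's `hcite`), the two r8's, (T1), and — for `False` — ONE persistent non-zero holomorphic fixed vector (Stage 1's theta
class: `false_pin_of_thm418C_two_keys_of_holomorphic_witness`).

READING (no verdict).  Whichever of `h418` ∕ `h418′` is the content reading of [Liu2021, Thm. 4.18] (the coordinator's WORLD word), the OTHER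
is refuted in the tree's model as soon as (T1) lands and one theta class is non-zero — independently of the Weil-module lemma (T4) and of
the index involution (T2).

References: [Liu2021] Y. Liu, *Fourier–Jacobi cycles and arithmetic relative trace formula*, Camb. J. Math. 9 (2021), Prop. 4.13, Thm. 4.18,
Rem. 4.4; [VoisinHodgeI2002] C. Voisin, *Hodge Theory and Complex Algebraic Geometry I*, §6.1.3 Cor. 6.12 ∕ 6.14; [Shimura1998] G. Shimura,
*Abelian Varieties with Complex Multiplication and Modular Functions*, §5.2, §8.3 Prop. 28.
-/

set_option autoImplicit false

noncomputable section

open scoped TensorProduct DirectSum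
open CategoryTheory Module

namespace Summit.HodgeConjecture.CorCM.D2Bridge

open NumberField NumberField.ComplexEmbedding
open Literature.AlgebraicGeometry.Motives (SchemeOver IsSmoothProjective CMType AbelianVariety bettiCohomology
  ofRatClassBaseChange ComplexPoints)
open Literature.AlgebraicGeometry.HodgeTheory (complexBetti IsOfHodgeType exists_isReal_hodgeModel hodgePQ_independent_of_hodgeModel
  conjClass_ofRatClassBaseChange)
open Literature.NumberTheory.Automorphic.PicardCM
open Literature.NumberTheory.ComplexMultiplication
open Literature.NumberTheory.ComplexMultiplication.CMTypeOps (mem_iff_conjugate_notMem)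
open Literature.NumberTheory.Transcendental (Arapura2012_Cor_15_4_6)
open HodgeCM HodgeCM.Model HodgeCM.Model.LiuDictionary HodgeCM.LiuJunction
open HodgeCM.Literature.Theta HodgeCM.Literature.Theta.LiuAlbaneseModuleDatum

variable {hHD : exists_isReal_hodgeModel} {hI : hodgePQ_independent_of_hodgeModel}
  {h₁ : BallQuotientUniformised} {h₃ : CMAbelianVarietyRealised}
variable {L : CMField} {ι₁ : (L : Type) →+* ℂ} {V : HermSpace3 L ι₁}

/-! ## §0 `conj ⊗ id` swaps the Hodge pieces of `H¹(P_K)` (local copies of the wb-5 lemmas; private, to keep this file import-light) -/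

/-- `conj ⊗ id` carries `H^{1,0}(P_K)` into `H^{0,1}(P_K)`. [cite: VoisinHodgeI2002, §6.1.3 Cor. 6.12] -/
private theorem conj_mem_piece01 (K : Level V)
    {x : (picardCMUniverse hHD hI h₁ h₃).CohC ((picardCMUniverse hHD hI h₁ h₃).pms L ι₁ V K) 1}
    (hx : x ∈ ((picardCMUniverse hHD hI h₁ h₃).hodge ((picardCMUniverse hHD hI h₁ h₃).pms L ι₁ V K) 1).piece 1 0) :
    Literature.AlgebraicGeometry.Motives.HodgeStructure.conj x ∈
      ((picardCMUniverse hHD hI h₁ h₃).hodge ((picardCMUniverse hHD hI h₁ h₃).pms L ι₁ V K) 1).piece 0 1 := by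
  rw [hodge_pms_eq] at hx ⊢
  have h10 := (Literature.AlgebraicGeometry.HodgeTheory.BettiUniverse.mem_hodge_piece_iff hHD hI
    (isSmoothProjective_pms (h₁ := h₁) K) (k := 1) (p := 1) (q := 0) rfl x).1 hx
  have h01 := h10.conjClass (isSmoothProjective_pms (h₁ := h₁) K)
  rw [conjClass_ofRatClassBaseChange] at h01
  exact (Literature.AlgebraicGeometry.HodgeTheory.BettiUniverse.mem_hodge_piece_iff hHD hI
    (isSmoothProjective_pms (h₁ := h₁) K) (k := 1) (p := 0) (q := 1) rfl _).2 h01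

/-- `conj x = 0 → x = 0` on `ℂ ⊗_ℚ W`. [folklore] -/
private theorem eq_zero_of_conj_eq_zero' {W : Type*} [AddCommGroup W] [Module ℚ W] {x : ℂ ⊗[ℚ] W}
    (h : Literature.AlgebraicGeometry.Motives.HodgeStructure.conj x = 0) : x = 0 := by
  rw [← Literature.AlgebraicGeometry.Motives.HodgeStructure.conj_conj x, h, map_zero]

/-! ## §1 Generic: one dictionary, two keys, Prop. 4.13, (T1) -/

/-- **TWO KEYINGS OF r8 + [Liu2021, Prop. 4.13] + (T1) KILL THE HOLOMORPHIC FIXED VECTORS.**  See the module docstring.  Displayed: `T.Prop413`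
(the decomposition), `T.Thm418C` (key 1), `h418₂` (key 2, unfolded r8 for `(P₂, cmCl₂)` on the same `H ∕ block ∕ res`), the dichotomy `hP`,
the two `(1,0)`-typings of the generator sets, and (T1) `F ∕ hFfix ∕ hres`.  Conclusion per vector `x ∈ T.H`: a threshold `Γ₀` below which
«`Γ.K`-fixed and `T.res Γ x ∈ H^{1,0}(P_Γ)`» implies `T.res Γ x = 0`.
[cite: Liu2021, Prop. 4.13 and Thm. 4.18] [cite: VoisinHodgeI2002, §6.1.3 Cor. 6.12 and Cor. 6.14] -/
theorem res_eq_zero_of_thm418C_two_keys (T : LiuDictionary hHD hI h₁ h₃ V)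
    (h413 : T.Prop413) (h418₁ : T.Thm418C)
    (P₂ : T.Char → Prop)
    (cmCl₂ : ∀ K : Level V, T.Char → Set ((picardCMUniverse hHD hI h₁ h₃).CohC ((picardCMUniverse hHD hI h₁ h₃).pms L ι₁ V K) 1))
    (h418₂ : ∀ μ : T.Char, P₂ μ → ∃ K₀ : Level V, ∀ K ≤ K₀, ∀ x ∈ T.block μ, x ∈ fixedBy K.K T.H →
      T.res K x ∈ Submodule.span ℂ (cmCl₂ K μ))
    (hP : ∀ μ : T.Char, T.PhiMu μ ∨ P₂ μ)
    (hCl₁ : ∀ (K : Level V) (μ : T.Char), T.PhiMu μ →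
      T.cmClasses K μ ⊆ ((picardCMUniverse hHD hI h₁ h₃).hodge ((picardCMUniverse hHD hI h₁ h₃).pms L ι₁ V K) 1).piece 1 0)
    (hCl₂ : ∀ (K : Level V) (μ : T.Char), P₂ μ →
      cmCl₂ K μ ⊆ ((picardCMUniverse hHD hI h₁ h₃).hodge ((picardCMUniverse hHD hI h₁ h₃).pms L ι₁ V K) 1).piece 1 0)
    (F : T.H → T.H) (hFfix : ∀ (Γ : Level V) (x : T.H), x ∈ fixedBy Γ.K T.H → F x ∈ fixedBy Γ.K T.H)
    (hres : ∀ (Γ : Level V) (x : T.H), x ∈ fixedBy Γ.K T.H →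
      T.res Γ (F x) = Literature.AlgebraicGeometry.Motives.HodgeStructure.conj (T.res Γ x))
    (x : T.H) :
    ∃ Γ₀ : Level V, ∀ Γ ≤ Γ₀, x ∈ fixedBy Γ.K T.H →
      T.res Γ x ∈ ((picardCMUniverse hHD hI h₁ h₃).hodge ((picardCMUniverse hHD hI h₁ h₃).pms L ι₁ V Γ) 1).piece 1 0 →
        T.res Γ x = 0 := by
  classical
  obtain ⟨e⟩ := h413
  -- one threshold per character, below which the fixed vectors of `block μ` restrict into `H^{1,0}` (key 1 or key 2)
  have hthr : ∀ μ : T.Char, ∃ K₀ : Level V, ∀ K ≤ K₀, ∀ z ∈ T.block μ, z ∈ fixedBy K.K T.H →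
      T.res K z ∈ ((picardCMUniverse hHD hI h₁ h₃).hodge ((picardCMUniverse hHD hI h₁ h₃).pms L ι₁ V K) 1).piece 1 0 := by
    intro μ
    rcases hP μ with hμ | hμ
    · obtain ⟨K₀, hK₀⟩ := h418₁ μ hμ
      exact ⟨K₀, fun K hK z hz hf => (Submodule.span_le.2 (hCl₁ K μ hμ)) (hK₀ K hK z hz hf)⟩
    · obtain ⟨K₀, hK₀⟩ := h418₂ μ hμ
      exact ⟨K₀, fun K hK z hz hf => (Submodule.span_le.2 (hCl₂ K μ hμ)) (hK₀ K hK z hz hf)⟩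
  choose K₀ hK₀ using hthr
  -- the Prop. 4.13 components of `y := F x`
  set y : T.H := F x with hy
  let Lt : T.Triple → (T.H →ₗ[adelicAlgebra V] T.H) := fun t =>
    e.symm.toLinearMap ∘ₗ DirectSum.lof (adelicAlgebra V) T.Triple T.Ωt t ∘ₗ
      DirectSum.component (adelicAlgebra V) T.Triple T.Ωt t ∘ₗ e.toLinearMap
  have hysum : y = ∑ t ∈ DFinsupp.support (e y), Lt t y := eq_sum_support e y
  have hyt_block : ∀ t, Lt t y ∈ T.block t.1 := by
    intro t
    refine oscImage_le_block t (range_le_oscImage t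
      (e.symm.toLinearMap ∘ₗ DirectSum.lof (adelicAlgebra V) T.Triple T.Ωt t) ?_)
    exact ⟨DirectSum.component (adelicAlgebra V) T.Triple T.Ωt t (e y), rfl⟩
  -- the threshold: the minimum over the (finite) support of `e y`
  let S : Finset T.Triple := DFinsupp.support (e y)
  refine ⟨if hS : S.Nonempty then S.inf' hS (fun t => K₀ t.1) else Level.three V, fun Γ hΓ hfix h10 => ?_⟩
  have hΓt : ∀ t ∈ S, Γ ≤ K₀ t.1 := fun t htS => by
    have hS : S.Nonempty := ⟨t, htS⟩
    rw [dif_pos hS] at hΓ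
    exact hΓ.trans (Finset.inf'_le (fun t => K₀ t.1) htS)
  -- `y` and its components are `Γ.K`-fixed
  have hyfix : y ∈ fixedBy Γ.K T.H := hFfix Γ x hfix
  have hyt_fixed : ∀ t, Lt t y ∈ fixedBy Γ.K T.H := by
    intro t k hk
    rw [← (Lt t).map_smul, hyfix k hk]
  -- so `T.res Γ y` is a finite sum of `(1,0)`-classes
  have hres10 : T.res Γ y ∈
      ((picardCMUniverse hHD hI h₁ h₃).hodge ((picardCMUniverse hHD hI h₁ h₃).pms L ι₁ V Γ) 1).piece 1 0 := by
    rw [hysum, map_sum]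
    exact Submodule.sum_mem _ fun t htS => hK₀ t.1 Γ (hΓt t htS) (Lt t y) (hyt_block t) (hyt_fixed t)
  -- while `T.res Γ y = conj (T.res Γ x)` is `(0,1)`
  rw [hy, hres Γ x hfix] at hres10
  have hres01 := conj_mem_piece01 (hHD := hHD) (hI := hI) (h₁ := h₁) (h₃ := h₃) Γ h10
  exact eq_zero_of_conj_eq_zero'
    ((Submodule.disjoint_def.1 (disjoint_hodgePiece_one_zero hHD hI h₁ h₃ Γ)) _ hres10 hres01)

/-- **Inconsistency form.**  Under the same data, a PERSISTENT non-zero holomorphic fixed vector (`∃ x, ∀ Γ₀, ∃ Γ ≤ Γ₀`, `x ∈ H^{Γ.K}`,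
`T.res Γ x ∈ H^{1,0}`, `T.res Γ x ≠ 0` — the shape in which Stage 1 supplies a theta class at all small levels) is a CONTRADICTION: the two
keyings of r8 are not jointly inhabitable next to it. [cite: Liu2021, Prop. 4.13 and Thm. 4.18] [cite: VoisinHodgeI2002, §6.1.3 Cor. 6.14] -/
theorem false_of_thm418C_two_keys_of_holomorphic_witness (T : LiuDictionary hHD hI h₁ h₃ V)
    (h413 : T.Prop413) (h418₁ : T.Thm418C)
    (P₂ : T.Char → Prop)
    (cmCl₂ : ∀ K : Level V, T.Char → Set ((picardCMUniverse hHD hI h₁ h₃).CohC ((picardCMUniverse hHD hI h₁ h₃).pms L ι₁ V K) 1))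
    (h418₂ : ∀ μ : T.Char, P₂ μ → ∃ K₀ : Level V, ∀ K ≤ K₀, ∀ x ∈ T.block μ, x ∈ fixedBy K.K T.H →
      T.res K x ∈ Submodule.span ℂ (cmCl₂ K μ))
    (hP : ∀ μ : T.Char, T.PhiMu μ ∨ P₂ μ)
    (hCl₁ : ∀ (K : Level V) (μ : T.Char), T.PhiMu μ →
      T.cmClasses K μ ⊆ ((picardCMUniverse hHD hI h₁ h₃).hodge ((picardCMUniverse hHD hI h₁ h₃).pms L ι₁ V K) 1).piece 1 0)
    (hCl₂ : ∀ (K : Level V) (μ : T.Char), P₂ μ →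
      cmCl₂ K μ ⊆ ((picardCMUniverse hHD hI h₁ h₃).hodge ((picardCMUniverse hHD hI h₁ h₃).pms L ι₁ V K) 1).piece 1 0)
    (F : T.H → T.H) (hFfix : ∀ (Γ : Level V) (x : T.H), x ∈ fixedBy Γ.K T.H → F x ∈ fixedBy Γ.K T.H)
    (hres : ∀ (Γ : Level V) (x : T.H), x ∈ fixedBy Γ.K T.H →
      T.res Γ (F x) = Literature.AlgebraicGeometry.Motives.HodgeStructure.conj (T.res Γ x))
    (hθ : ∃ x : T.H, ∀ Γ₀ : Level V, ∃ Γ ≤ Γ₀, x ∈ fixedBy Γ.K T.H ∧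
      T.res Γ x ∈ ((picardCMUniverse hHD hI h₁ h₃).hodge ((picardCMUniverse hHD hI h₁ h₃).pms L ι₁ V Γ) 1).piece 1 0 ∧
        T.res Γ x ≠ 0) : False := by
  obtain ⟨x, hx⟩ := hθ
  obtain ⟨Γ₀, hΓ₀⟩ := res_eq_zero_of_thm418C_two_keys T h413 h418₁ P₂ cmCl₂ h418₂ hP hCl₁ hCl₂ F hFfix hres x
  obtain ⟨Γ, hΓ, hfix, h10, hne⟩ := hx Γ₀
  exact hne (hΓ₀ Γ hΓ hfix h10)

/-! ## §2 At the literal pin: live `liuDictionaryPin` as key 1, the re-keyed twin (written out) as key 2 -/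

section Pin

variable (V) (I : Type) (line : I → SplitLineE V)

/-- The CM-type dichotomy at the pin: `ι₁ ∈ Φ ∨ ῑ₁ ∈ Φ`. [folklore] -/
private theorem mem_or_starRingEnd_comp_mem (Φ : CMType (L : Type)) :
    ι₁ ∈ Φ.1 ∨ (starRingEnd ℂ).comp ι₁ ∈ Φ.1 := by
  by_cases h : ι₁ ∈ Φ.1
  · exact Or.inl h
  · refine Or.inr ?_
    have hc : (starRingEnd ℂ).comp ι₁ = conjugate ι₁ := RingHom.ext fun _ => rfl
    rw [hc]
    by_contra hc'
    exact h ((mem_iff_conjugate_notMem Φ ι₁).2 hc')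

/-- The re-keyed twin's generator sets at a line with `ῑ₁ ∈ Φ_i` are `(1,0)` (K2 through the conjugate pin + T1 kernel test).
[cite: Shimura1998, §8.3 Prop. 28] [cite: VoisinHodgeI2002, §7.3.2] -/
private theorem cmClasses_rekeyPin_subset_piece_one_zero [IsGalois ℚ (L : Type)]
    (hHD : exists_isReal_hodgeModel) (hI : hodgePQ_independent_of_hodgeModel) (h₁ : BallQuotientUniformised)
    (h₃ : CMAbelianVarietyRealised) (hA : Arapura2012_Cor_15_4_6) (K : Level V) (i : I)
    (hi : (starRingEnd ℂ).comp ι₁ ∈ (SplitLine.typeOfLine (line i)).1) :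
    (LiuDictionary.ofTower hHD hI h₁ h₃ hA V I (fun i => {χ : (line i).CharW // (line i).IsAutChar χ})
      (fun i a => (line i).Ω (ιVE V) a.1) (fun i => SplitLine.PhiMuLine ((starRingEnd ℂ).comp ι₁) (line i))
      (fun i dd => dd.IsReflexOfTypeG ((starRingEnd ℂ).comp ι₁) (SplitLine.typeOfLine (line i)))).cmClasses K i ⊆
      ((picardCMUniverse hHD hI h₁ h₃).hodge ((picardCMUniverse hHD hI h₁ h₃).pms L ι₁ V K) 1).piece 1 0 :=
  cmClasses_subset_hodge_piece_one_zero
    (LiuDictionary.ofTower hHD hI h₁ h₃ hA V I (fun i => {χ : (line i).CharW // (line i).IsAutChar χ})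
      (fun i a => (line i).Ω (ιVE V) a.1) (fun i => SplitLine.PhiMuLine ((starRingEnd ℂ).comp ι₁) (line i))
      (fun i dd => dd.IsReflexOfTypeG ((starRingEnd ℂ).comp ι₁) (SplitLine.typeOfLine (line i)))) K i
    (fun d hd => tau_mem_cmType_of_isReflexOfType_starRingEnd_comp ι₁ d (SplitLine.typeOfLine (line i)) (hd inferInstance) hi)

/-- **AT THE LITERAL PIN.**  Key 1 = the live `liuDictionaryPin hHD hI h₁ h₃ hA V I line`; key 2 = its re-keyed twin WRITTEN OUT
(`LiuDictionary.ofTower … (fun i => PhiMuLine ῑ₁ (line i)) (fun i d => d.IsReflexOfTypeG ῑ₁ (typeOfLine (line i)))`, `ῑ₁ := conj ∘ ι₁`; the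
(c-S.1) chain's `Rekey.liuDictionaryPin` by `rfl`).  `L/ℚ` Galois.  Displayed: [Liu2021, Prop. 4.13] at the live pin, BOTH r8's, (T1).  The
dichotomy and the two `(1,0)`-typings are discharged (CM-type axiom; K2 `tau_mem_cmType_of_isReflexOfType` ∕ `…_starRingEnd_comp`;
✔ `cmClasses_subset_hodge_piece_one_zero`).  Conclusion: every tower vector's holomorphic `Γ.K`-fixed restrictions vanish below a threshold.
[cite: Liu2021, Prop. 4.13, Thm. 4.18, Remark 4.4 (TeX ll. 1930–1933)] [cite: Shimura1998, §8.3 Prop. 28] [cite: VoisinHodgeI2002, §6.1.3 Cor. 6.14] -/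
theorem res_eq_zero_pin_of_thm418C_two_keys [IsGalois ℚ (L : Type)]
    (hHD : exists_isReal_hodgeModel) (hI : hodgePQ_independent_of_hodgeModel) (h₁ : BallQuotientUniformised)
    (h₃ : CMAbelianVarietyRealised) (hA : Arapura2012_Cor_15_4_6)
    (h413 : (liuDictionaryPin hHD hI h₁ h₃ hA V I line).Prop413)
    (h418 : (liuDictionaryPin hHD hI h₁ h₃ hA V I line).Thm418C)
    (h418' : (LiuDictionary.ofTower hHD hI h₁ h₃ hA V I (fun i => {χ : (line i).CharW // (line i).IsAutChar χ})
      (fun i a => (line i).Ω (ιVE V) a.1) (fun i => SplitLine.PhiMuLine ((starRingEnd ℂ).comp ι₁) (line i))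
      (fun i dd => dd.IsReflexOfTypeG ((starRingEnd ℂ).comp ι₁) (SplitLine.typeOfLine (line i)))).Thm418C)
    (F : (liuDictionaryPin hHD hI h₁ h₃ hA V I line).H → (liuDictionaryPin hHD hI h₁ h₃ hA V I line).H)
    (hFfix : ∀ (Γ : Level V) (x : (liuDictionaryPin hHD hI h₁ h₃ hA V I line).H),
      x ∈ fixedBy Γ.K (liuDictionaryPin hHD hI h₁ h₃ hA V I line).H → F x ∈ fixedBy Γ.K (liuDictionaryPin hHD hI h₁ h₃ hA V I line).H)
    (hres : ∀ (Γ : Level V) (x : (liuDictionaryPin hHD hI h₁ h₃ hA V I line).H),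
      x ∈ fixedBy Γ.K (liuDictionaryPin hHD hI h₁ h₃ hA V I line).H →
        (liuDictionaryPin hHD hI h₁ h₃ hA V I line).res Γ (F x) =
          Literature.AlgebraicGeometry.Motives.HodgeStructure.conj ((liuDictionaryPin hHD hI h₁ h₃ hA V I line).res Γ x))
    (x : (liuDictionaryPin hHD hI h₁ h₃ hA V I line).H) :
    ∃ Γ₀ : Level V, ∀ Γ ≤ Γ₀, x ∈ fixedBy Γ.K (liuDictionaryPin hHD hI h₁ h₃ hA V I line).H →
      (liuDictionaryPin hHD hI h₁ h₃ hA V I line).res Γ x ∈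
          ((picardCMUniverse hHD hI h₁ h₃).hodge ((picardCMUniverse hHD hI h₁ h₃).pms L ι₁ V Γ) 1).piece 1 0 →
        (liuDictionaryPin hHD hI h₁ h₃ hA V I line).res Γ x = 0 := by
  refine res_eq_zero_of_thm418C_two_keys (liuDictionaryPin hHD hI h₁ h₃ hA V I line) h413 h418
    (fun i => (starRingEnd ℂ).comp ι₁ ∈ (SplitLine.typeOfLine (line i)).1)
    (fun K i => (LiuDictionary.ofTower hHD hI h₁ h₃ hA V I (fun i => {χ : (line i).CharW // (line i).IsAutChar χ})
      (fun i a => (line i).Ω (ιVE V) a.1) (fun i => SplitLine.PhiMuLine ((starRingEnd ℂ).comp ι₁) (line i))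
      (fun i dd => dd.IsReflexOfTypeG ((starRingEnd ℂ).comp ι₁) (SplitLine.typeOfLine (line i)))).cmClasses K i)
    (fun i hi => h418' i hi) (fun i => mem_or_starRingEnd_comp_mem (ι₁ := ι₁) (SplitLine.typeOfLine (line i)))
    (fun K i hi => ?_) (fun K i hi => ?_) F hFfix hres x
  · -- key 1: `ι₁ ∈ Φ_i` ⇒ every `ι₁`-admissible record has `τ ∈ ΦA` (K2) ⇒ generators `(1,0)`
    exact cmClasses_subset_hodge_piece_one_zero (liuDictionaryPin hHD hI h₁ h₃ hA V I line) K i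
      (fun d hd => tau_mem_cmType_of_isReflexOfType ι₁ d (SplitLine.typeOfLine (line i)) (hd inferInstance) hi)
  · -- key 2: `ῑ₁ ∈ Φ_i` ⇒ every `ῑ₁`-admissible record has `τ ∈ ΦA` (K2 through the conjugate pin) ⇒ generators `(1,0)`
    exact cmClasses_rekeyPin_subset_piece_one_zero V I line hHD hI h₁ h₃ hA K i hi

/-- **AT THE LITERAL PIN, inconsistency form**: [Liu2021, Prop. 4.13] (live pin) + `h418` + `h418′` + (T1) + ONE persistent non-zero
holomorphic fixed vector of the tower ⇒ `False`. [cite: Liu2021, Prop. 4.13, Thm. 4.18, Remark 4.4 (TeX ll. 1930–1933)]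
[cite: VoisinHodgeI2002, §6.1.3 Cor. 6.14] -/
theorem false_pin_of_thm418C_two_keys_of_holomorphic_witness [IsGalois ℚ (L : Type)]
    (hHD : exists_isReal_hodgeModel) (hI : hodgePQ_independent_of_hodgeModel) (h₁ : BallQuotientUniformised)
    (h₃ : CMAbelianVarietyRealised) (hA : Arapura2012_Cor_15_4_6)
    (h413 : (liuDictionaryPin hHD hI h₁ h₃ hA V I line).Prop413)
    (h418 : (liuDictionaryPin hHD hI h₁ h₃ hA V I line).Thm418C)
    (h418' : (LiuDictionary.ofTower hHD hI h₁ h₃ hA V I (fun i => {χ : (line i).CharW // (line i).IsAutChar χ})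
      (fun i a => (line i).Ω (ιVE V) a.1) (fun i => SplitLine.PhiMuLine ((starRingEnd ℂ).comp ι₁) (line i))
      (fun i dd => dd.IsReflexOfTypeG ((starRingEnd ℂ).comp ι₁) (SplitLine.typeOfLine (line i)))).Thm418C)
    (F : (liuDictionaryPin hHD hI h₁ h₃ hA V I line).H → (liuDictionaryPin hHD hI h₁ h₃ hA V I line).H)
    (hFfix : ∀ (Γ : Level V) (x : (liuDictionaryPin hHD hI h₁ h₃ hA V I line).H),
      x ∈ fixedBy Γ.K (liuDictionaryPin hHD hI h₁ h₃ hA V I line).H → F x ∈ fixedBy Γ.K (liuDictionaryPin hHD hI h₁ h₃ hA V I line).H)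
    (hres : ∀ (Γ : Level V) (x : (liuDictionaryPin hHD hI h₁ h₃ hA V I line).H),
      x ∈ fixedBy Γ.K (liuDictionaryPin hHD hI h₁ h₃ hA V I line).H →
        (liuDictionaryPin hHD hI h₁ h₃ hA V I line).res Γ (F x) =
          Literature.AlgebraicGeometry.Motives.HodgeStructure.conj ((liuDictionaryPin hHD hI h₁ h₃ hA V I line).res Γ x))
    (hθ : ∃ x : (liuDictionaryPin hHD hI h₁ h₃ hA V I line).H, ∀ Γ₀ : Level V, ∃ Γ ≤ Γ₀,
      x ∈ fixedBy Γ.K (liuDictionaryPin hHD hI h₁ h₃ hA V I line).H ∧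
        (liuDictionaryPin hHD hI h₁ h₃ hA V I line).res Γ x ∈
          ((picardCMUniverse hHD hI h₁ h₃).hodge ((picardCMUniverse hHD hI h₁ h₃).pms L ι₁ V Γ) 1).piece 1 0 ∧
        (liuDictionaryPin hHD hI h₁ h₃ hA V I line).res Γ x ≠ 0) : False := by
  obtain ⟨x, hx⟩ := hθ
  obtain ⟨Γ₀, hΓ₀⟩ := res_eq_zero_pin_of_thm418C_two_keys V I line hHD hI h₁ h₃ hA h413 h418 h418' F hFfix hres x
  obtain ⟨Γ, hΓ, hfix, h10, hne⟩ := hx Γ₀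
  exact hne (hΓ₀ Γ hΓ hfix h10)

end Pin

end Summit.HodgeConjecture.CorCM.D2Bridge

end
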